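import Mathlib
import Summits.AtomisticToContinuum.HydrodynamicLimit.Theorems.ImplosionDichotomyDenseExcursionSonicSmoothBranchGapSonicPair
import Summits.AtomisticToContinuum.HydrodynamicLimit.Theorems.ImplosionDichotomyDenseExcursionSonicSmoothBranchCkChar
import Summits.AtomisticToContinuum.HydrodynamicLimit.Theorems.ImplosionDichotomyDenseExcursionSonicSmoothBranchCk

/-!
# The canonical smooth homogeneous branch at the sonic point with `C^k` bounds uniform in `Λ` (brick (β) for theorem T7(i))
# (crux `DenseExcursion`, line `sonic-cavity-renewal`, brick for stub `stub_cavityResolventCk`)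

Helper file (`--supports stmt-AtomisticToContinuum-12586`, line lead a2, stub-worker E1 for `stub_cavityResolventCk`).
Registered helper `sonic_hom_branch_Ck`: for a monatomic tube profile, `k : ℕ`, a bound `R` and a gap `μ > 0` there are
`ρ > 0` and `C` such that for every `Λ` with `‖Λ‖ ≤ R` and `‖n ∓ ν(Λ)‖ ≥ μ` for all `n : ℕ` (`ν(Λ) = (b₊₊(0) − Λ)/κ`)
the HOMOGENEOUS resolvent equation `Λŵ = linW`, `Λŝ = linS` has a `C^∞` solution on `(−ρ, ρ)` with the normalisation
`ŵ(0) − 3ŝ(0) = 1` and `‖(d/dx)ⁱ ŵ‖, ‖(d/dx)ⁱ ŝ‖ ≤ C` on `(−ρ, ρ)` for all `i ≤ k` — the radius and the bound UNIFORM in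
`Λ`. It is the analytic Frobenius branch `(a₁, a₂)` of exponent `0` of `sonic_frobenius_pair_gap` (`a₂(0) = 1`, `C^k`
bounds `C_b`), read through the characteristic fields `p = ŵ + 3ŝ = a₁`, `q = ŵ − 3ŝ = a₂` (`lin_iff_char`; the `q`-row
at `x = 0` by continuity, `eq_zero_of_eq_zero_off_zero`). This is the canonical smooth homogeneous branch of the matching
step (T6: `q(0) = 1`; by the uniqueness half of `sonic_char_branch` it is THE smooth homogeneous local solution with
`q(0) = 1` off the axis), whose `C^k` control uniform in `Λ` is one of the two quantitative inputs (with a quantitative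
centre branch) of the continuity-in-`Λ` argument behind the compact uniformity T7(i); no condition `Re ν ≤ k − 1` is
needed for the homogeneous branch. Sources: folklore (Coddington–Levinson 1955 Ch. 4).
-/

noncomputable section

open Set Filter
open scoped Topology ContDiff

namespace Summit.AtomisticToContinuum.HydrodynamicLimit.Theorems.SonicCavityRenewal

open Summit.AtomisticToContinuum.HydrodynamicLimit.Theorems.R2OneModeTwoConditions

/-- Iterated derivatives of `(u ± v)/c`-type combinations are bounded by the bounds of `u`, `v`. [folklore] -/
theorem norm_iteratedDeriv_combo_le {u v : ℝ → ℂ} {i : ℕ} {x : ℝ} {C : ℝ} (a b : ℂ) (hu : ContDiffAt ℝ i u x)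
    (hv : ContDiffAt ℝ i v x) (hbu : ‖iteratedDeriv i u x‖ ≤ C) (hbv : ‖iteratedDeriv i v x‖ ≤ C) :
    ‖iteratedDeriv i (fun y => a * u y + b * v y) x‖ ≤ (‖a‖ + ‖b‖) * C := by
  have h1 : iteratedDeriv i (fun y => a * u y) x = a * iteratedDeriv i u x := iteratedDeriv_const_mul a hu
  have h2 : iteratedDeriv i (fun y => b * v y) x = b * iteratedDeriv i v x := iteratedDeriv_const_mul b hv
  have hau : ContDiffAt ℝ i (fun y => a * u y) x := contDiff_const.contDiffAt.mul hu
  have hbv' : ContDiffAt ℝ i (fun y => b * v y) x := contDiff_const.contDiffAt.mul hv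
  rw [iteratedDeriv_fun_add hau hbv', h1, h2]
  calc ‖a * iteratedDeriv i u x + b * iteratedDeriv i v x‖ ≤ ‖a‖ * ‖iteratedDeriv i u x‖ + ‖b‖ * ‖iteratedDeriv i v x‖ :=
        (norm_add_le _ _).trans (by rw [norm_mul, norm_mul])
    _ ≤ ‖a‖ * C + ‖b‖ * C := add_le_add (mul_le_mul_of_nonneg_left hbu (norm_nonneg _))
        (mul_le_mul_of_nonneg_left hbv (norm_nonneg _))
    _ = (‖a‖ + ‖b‖) * C := by ring

/-- **Registered helper `sonic_hom_branch_Ck`: THE CANONICAL SMOOTH HOMOGENEOUS BRANCH AT THE SONIC POINT WITH `C^k` BOUNDS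
UNIFORM IN `Λ`.** See the module docstring. [folklore] -/
theorem sonic_hom_branch_Ck : ∀ (r : ℝ) (W S : ℝ → ℝ), IsMonatomicProfile r W S → CavityTube r W S → ∀ (k : ℕ) (R μ : ℝ), 0 < μ → ∃ ρ : ℝ, 0 < ρ ∧ ∃ C : ℝ, 0 ≤ C ∧ ∀ Λ : ℂ, ‖Λ‖ ≤ R → (∀ n : ℕ, μ ≤ ‖(n : ℂ) - ((((2 / 3 * deriv W 0 + 2 * deriv S 0 + 2 * W 0 + 4 * S 0 - r : ℝ) : ℂ) - Λ) / ((-(deriv W 0 + deriv S 0) : ℝ) : ℂ))‖ ∧ μ ≤ ‖(n : ℂ) + ((((2 / 3 * deriv W 0 + 2 * deriv S 0 + 2 * W 0 + 4 * S 0 - r : ℝ) : ℂ) - Λ) / ((-(deriv W 0 + deriv S 0) : ℝ) : ℂ))‖) → ∃ ŵ ŝ : ℝ → ℂ, ContDiffOn ℝ ∞ ŵ (Set.Ioo (-ρ) ρ) ∧ ContDiffOn ℝ ∞ ŝ (Set.Ioo (-ρ) ρ) ∧ ŵ 0 - 3 * ŝ 0 = 1 ∧ (∀ x ∈ Set.Ioo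 (-ρ) ρ, Λ * ŵ x - linW r W S ŵ ŝ x = 0 ∧ Λ * ŝ x - linS r W S ŵ ŝ x = 0) ∧ ∀ i : ℕ, i ≤ k → ∀ x ∈ Set.Ioo (-ρ) ρ, ‖iteratedDeriv i ŵ x‖ ≤ C ∧ ‖iteratedDeriv i ŝ x‖ ≤ C := by
  intro r W S hP hT k R μ hμ
  obtain ⟨ρ, hρ, -, hxη, -, -, -, hne, Cb, hCb, -, hpairΛ⟩ := sonic_frobenius_pair_gap r W S hP hT k R μ hμ
  obtain ⟨-, -, hW, hS, -, -⟩ := hP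
  have hU : IsOpen (Ioo (-ρ) ρ) := isOpen_Ioo
  have h0U : (0 : ℝ) ∈ Ioo (-ρ) ρ := ⟨by linarith, hρ⟩
  refine ⟨ρ, hρ, Cb, hCb, fun Λ hΛ hgap => ?_⟩
  obtain ⟨a₁, a₂, ψ₁, ψ₂, χ, ha₁, ha₂, -, -, -, ha₂0, -, -, hode, -, hbd⟩ := hpairΛ Λ hΛ hgap
  have hdf : ∀ {φ : ℝ → ℂ}, ContDiffOn ℝ ∞ φ (Ioo (-ρ) ρ) → ∀ y ∈ Ioo (-ρ) ρ, HasDerivAt φ (deriv φ y) y :=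
    fun hφ y hy => ((hφ.differentiableOn (by simp)) y hy |>.differentiableAt (hU.mem_nhds hy)).hasDerivAt
  have hcA : ∀ {φ : ℝ → ℂ}, ContDiffOn ℝ ∞ φ (Ioo (-ρ) ρ) → ∀ y ∈ Ioo (-ρ) ρ, ∀ n : ℕ, ContDiffAt ℝ n φ y :=
    fun hφ y hy n => ((hφ y hy).contDiffAt (hU.mem_nhds hy)).of_le (by exact_mod_cast le_top)
  have hcp : ∀ x : ℝ, ((W x - 1 + S x : ℝ) : ℂ) = (x : ℂ) * ((dslope (fun y => W y - 1 + S y) 0 x : ℝ) : ℂ) := fun x => by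
    rw [← hxη x]; push_cast; ring
  -- the characteristic system for `(p, q) = (a₁, a₂)`
  have hchar : ∀ x ∈ Ioo (-ρ) ρ,
      ((W x - 1 + S x : ℝ) : ℂ) * deriv a₁ x = (Λ - ((2 / 3 * deriv W x + 2 * W x - r + 2 * deriv S x + 4 * S x : ℝ) : ℂ)) *
        a₁ x - ((deriv W x / 3 + deriv S x + 2 * S x : ℝ) : ℂ) * a₂ x ∧
      ((W x - 1 - S x : ℝ) : ℂ) * deriv a₂ x = -((deriv W x / 3 - deriv S x - 2 * S x : ℝ) : ℂ) * a₁ x +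
        (Λ - ((2 / 3 * deriv W x + 2 * W x - r - 2 * deriv S x - 4 * S x : ℝ) : ℂ)) * a₂ x := by
    intro x hx
    obtain ⟨hηx, hcmx⟩ := hne x hx
    have hη : ((dslope (fun y => W y - 1 + S y) 0 x : ℝ) : ℂ) ≠ 0 := Complex.ofReal_ne_zero.2 hηx
    obtain ⟨⟨e1, -⟩, -⟩ := hode x hx
    constructor
    · have hinv₁ : ((dslope (fun y => W y - 1 + S y) 0 x : ℝ) : ℂ) * ((dslope (fun y => W y - 1 + S y) 0 x : ℝ) : ℂ)⁻¹ = 1 :=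
        mul_inv_cancel₀ hη
      push_cast at e1
      rw [hcp x]
      push_cast
      linear_combination ((dslope (fun y => W y - 1 + S y) 0 x : ℝ) : ℂ) * e1 +
        ((Λ - (2 / 3 * ((deriv W x : ℝ) : ℂ) + 2 * ((W x : ℝ) : ℂ) - ((r : ℝ) : ℂ) + 2 * ((deriv S x : ℝ) : ℂ) +
          4 * ((S x : ℝ) : ℂ))) * a₁ x - (((deriv W x : ℝ) : ℂ) / 3 + ((deriv S x : ℝ) : ℂ) + 2 * ((S x : ℝ) : ℂ)) * a₂ x) * hinv₁
    · -- the `q`-row: off `0` divide by `x`, at `0` by continuity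
      have key : ∀ y ∈ Ioo (-ρ) ρ, y ≠ 0 → ((W y - 1 - S y : ℝ) : ℂ) * deriv a₂ y =
          -((deriv W y / 3 - deriv S y - 2 * S y : ℝ) : ℂ) * a₁ y +
            (Λ - ((2 / 3 * deriv W y + 2 * W y - r - 2 * deriv S y - 4 * S y : ℝ) : ℂ)) * a₂ y := by
        intro y hy hy0
        obtain ⟨⟨-, f2⟩, -⟩ := hode y hy
        have hc' : ((W y : ℝ) : ℂ) - 1 - ((S y : ℝ) : ℂ) ≠ 0 := by
          have := Complex.ofReal_ne_zero.2 (hne y hy).2.ne; push_cast at this; exact this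
        have hinv : (((W y : ℝ) : ℂ) - 1 - ((S y : ℝ) : ℂ)) * (((W y : ℝ) : ℂ) - 1 - ((S y : ℝ) : ℂ))⁻¹ = 1 :=
          mul_inv_cancel₀ hc'
        push_cast at f2 ⊢
        have hy0' : (y : ℂ) ≠ 0 := Complex.ofReal_ne_zero.2 hy0
        refine mul_left_cancel₀ hy0' ?_
        linear_combination (((W y : ℝ) : ℂ) - 1 - ((S y : ℝ) : ℂ)) * f2 +
          ((y : ℂ) * (-(((deriv W y : ℝ) : ℂ) / 3 - ((deriv S y : ℝ) : ℂ) - 2 * ((S y : ℝ) : ℂ)) * a₁ y +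
            (Λ - (2 / 3 * ((deriv W y : ℝ) : ℂ) + 2 * ((W y : ℝ) : ℂ) - ((r : ℝ) : ℂ) - 2 * ((deriv S y : ℝ) : ℂ) -
              4 * ((S y : ℝ) : ℂ))) * a₂ y)) * hinv
      rcases eq_or_ne x 0 with rfl | hx0
      · have hcont : ContinuousAt (fun y => ((W y - 1 - S y : ℝ) : ℂ) * deriv a₂ y -
            (-((deriv W y / 3 - deriv S y - 2 * S y : ℝ) : ℂ) * a₁ y +
              (Λ - ((2 / 3 * deriv W y + 2 * W y - r - 2 * deriv S y - 4 * S y : ℝ) : ℂ)) * a₂ y)) 0 := by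
          have hpc : ContinuousAt a₁ 0 := (ha₁.continuousOn 0 h0U).continuousAt (hU.mem_nhds h0U)
          have hqc : ContinuousAt a₂ 0 := (ha₂.continuousOn 0 h0U).continuousAt (hU.mem_nhds h0U)
          have hdq : ContinuousAt (deriv a₂) 0 := (ha₂.continuousOn_deriv_of_isOpen hU (by simp) 0 h0U).continuousAt
            (hU.mem_nhds h0U)
          have hW1 : Continuous W := hW.continuous
          have hS1 : Continuous S := hS.continuous
          have hWc : Continuous (deriv W) := hW.continuous_deriv (by simp)
          have hSc : Continuous (deriv S) := hS.continuous_deriv (by simp)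
          have hR : ∀ {f : ℝ → ℝ}, Continuous f → ContinuousAt (fun y => ((f y : ℝ) : ℂ)) 0 := fun hf =>
            (Complex.continuous_ofReal.comp hf).continuousAt
          exact ((hR (by fun_prop)).mul hdq).sub (((hR (by fun_prop)).neg.mul hpc).add
            ((continuousAt_const.sub (hR (by fun_prop))).mul hqc))
        have := eq_zero_of_eq_zero_off_zero hρ hcont fun y hy hy0 => sub_eq_zero.2 (key y hy hy0)
        exact sub_eq_zero.1 this
      · exact key x hx hx0
  -- back to `(ŵ, ŝ)`
  refine ⟨fun x => (a₁ x + a₂ x) / 2, fun x => (a₁ x - a₂ x) / 6, (ha₁.add ha₂).div_const _, (ha₁.sub ha₂).div_const _,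
    by simp only; rw [ha₂0]; ring, fun x hx => ?_, fun i hi x hx => ?_⟩
  · have dw : deriv (fun x => (a₁ x + a₂ x) / 2) x = (deriv a₁ x + deriv a₂ x) / 2 :=
      (((hdf ha₁ x hx).add (hdf ha₂ x hx)).div_const 2).deriv
    have ds : deriv (fun x => (a₁ x - a₂ x) / 6) x = (deriv a₁ x - deriv a₂ x) / 6 :=
      (((hdf ha₁ x hx).sub (hdf ha₂ x hx)).div_const 6).deriv
    refine (lin_iff_char r W S Λ (fun x => (a₁ x + a₂ x) / 2) (fun x => (a₁ x - a₂ x) / 6) 0 0 x).2 ?_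
    rw [dw, ds]
    obtain ⟨e1, e2⟩ := hchar x hx
    have h2 : (a₁ x + a₂ x) / 2 + 3 * ((a₁ x - a₂ x) / 6) = a₁ x := by ring
    have h3 : (a₁ x + a₂ x) / 2 - 3 * ((a₁ x - a₂ x) / 6) = a₂ x := by ring
    constructor
    · have h1 : (deriv a₁ x + deriv a₂ x) / 2 + 3 * ((deriv a₁ x - deriv a₂ x) / 6) = deriv a₁ x := by ring
      rw [h1, h2, h3]; linear_combination e1
    · have h1 : (deriv a₁ x + deriv a₂ x) / 2 - 3 * ((deriv a₁ x - deriv a₂ x) / 6) = deriv a₂ x := by ring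
      rw [h1, h2, h3]; linear_combination e2
  · obtain ⟨b1, b2, -⟩ := hbd i hi x hx
    have ew : (fun y => (a₁ y + a₂ y) / 2) = fun y => (1 / 2 : ℂ) * a₁ y + (1 / 2 : ℂ) * a₂ y := by
      funext y; ring
    have es : (fun y => (a₁ y - a₂ y) / 6) = fun y => (1 / 6 : ℂ) * a₁ y + (-(1 / 6) : ℂ) * a₂ y := by
      funext y; ring
    have n2 : ‖(1 / 2 : ℂ)‖ = 1 / 2 := by norm_num
    have n6 : ‖(1 / 6 : ℂ)‖ = 1 / 6 := by norm_num
    have n6' : ‖(-(1 / 6) : ℂ)‖ = 1 / 6 := by rw [norm_neg]; norm_num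
    constructor
    · rw [ew]
      refine (norm_iteratedDeriv_combo_le _ _ (hcA ha₁ x hx i) (hcA ha₂ x hx i) b1 b2).trans ?_
      rw [n2]; linarith
    · rw [es]
      refine (norm_iteratedDeriv_combo_le _ _ (hcA ha₁ x hx i) (hcA ha₂ x hx i) b1 b2).trans ?_
      rw [n6, n6']; linarith

end Summit.AtomisticToContinuum.HydrodynamicLimit.Theorems.SonicCavityRenewal

end
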